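import Summits.AnomalousDissipation.AnomalousDissipation.Theorems.SolenoidalFractalHomogenisationLagrangianStepSidebandCrushedResponseStatic
import Summits.AnomalousDissipation.AnomalousDissipation.Theorems.SolenoidalFractalHomogenisationLagrangianStepD1TailBoundDiag
import Summits.AnomalousDissipation.AnomalousDissipation.Theorems.SolenoidalFractalHomogenisationLagrangianStepSidebandXV0RPrep
import Summits.AnomalousDissipation.AnomalousDissipation.Theorems.SolenoidalFractalHomogenisationCubatureMoments
import Literature.Analysis.FunctionSpaces.TorusHeatSmoothing
import HarnessLib

/-!
# K1L_D `stub_D1_V0thg` (stmt-AnomalousDissipation-27980), R3′ lane, R3′-2 `D1TailCrushBound`: THE CRUSHED STATE of the cubature word's periodic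
# sideband response (the ν-plumbing of `Sideband.norm_responseExt_le_crushed_nu` for `W = cubatureWord.stretch MB`, `ν = r³`)

Helper file of route `SolenoidalFractalHomogenisation` (`--supports stmt-AnomalousDissipation-27980 --as helper`; one-generation hand
`leafhand-ad-solenoidalfractalh-1` g1, road E-c).  Lane A4 bounds the state of the response of source slot `j'` entering a pickup slot by
`e^{−θmin}·SUP` (`D1Tail.norm_responseExt_le_of_gap`, `SUP = (8π‖α_{j'}‖/r_ν)·‖P_{j'} v‖`).  The crushed lane replaces `e^{−θmin}` by `C·√ν`: this file
discharges, for the doubly stretched cubature word `W₁ = (cubatureWord.stretch MB).stretch (1/ν)` with `ν = r³`, every ν-dependent side condition of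
`Sideband.norm_responseExt_le_crushed_nu` (`𝔸 = ν•S ∈ NearIso(ν·10/11, ν·11/10) ∩ OddSmall(ν·11/200)` from the sectorial block window, box radius
`R0 ν ≥ ν⁻³` against the ν-free `C_R`, `2r² ≤ MB·τᵢ`, the period gap `θ ≤ e^{−θmin}`, the a priori bound `SUP`) and the ν-FREE feasibility of the crush
window shape from the slot data (`a² ≤ 3/4`, `|mᵢ|² ≤ 3`):
* §1 slot-data facts: `sum_e_mul_eq` (`êₗ·z = (vₗ·z)/√nₗ`), `sum_e_mul_eq_zero_of_vdot` / `_ne_zero_of_vdot` (real and complex), `coupling_sq_le`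
  (`a² ≤ 3/4`), `freqNormSq_slots_le` (`|mᵢ|² ≤ 3`), `crush_feasible` (the feasibility inequality of `ladder_crush_*` for `β = 11/200`, `l = 10/11`,
  `h = 11/10`);
* §2 ν-bookkeeping: `box_condition_R0` (`C_R ≤ (R0 r³ − 1)·r²` for `r ≤ 1/(C_R+1)`, `r ≤ 1/4`), `gap_le_exp_neg_θmin` (the period gap of the hopping slot);
* §3 **`crushed_state`** — for a source slot `j'` and a slot `i ≠ j'` HOPPING `m_{j'}` (`vᵢ·m_{j'} ≠ 0`) such that every slot cyclically strictly between
  `j'` and `i` is static (`v_l·m_{j'} = 0`): ν-free `C > 0`, `r₁ ∈ (0, 1/4]` with, for all `r ∈ (0, r₁]`, every block-window background `S` and every `v`,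
  `‖N̄ (startᵢ¹ + τᵢ¹) v‖ ≤ C·√(r³)·SUP` (`ν = r³`).
What is NOT here: the per-pair case analysis over `SidebandPathCensus` and the ε-twins of lane A4's cases A–E (`D1TailCrushBound` proper).  No definitions,
no sorry.  NOT a proof of `stub_D1_V0thg`, of K1L_D or of AD; rung F-D1.A0 infrastructure.
-/

set_option linter.dupNamespace false

noncomputable section

namespace Summit.AnomalousDissipation.AnomalousDissipation.Theorems.SolenoidalFractalHomogenisation.LagrangianStep.D1Tail

open Summit.AnomalousDissipation.AnomalousDissipation.Theorems
open Summit.AnomalousDissipation.AnomalousDissipation.Theorems.SolenoidalFractalHomogenisation.LagrangianStep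
open Summit.AnomalousDissipation.AnomalousDissipation.Theorems.SolenoidalFractalHomogenisation.LagrangianStep.WCrossing
open Summit.AnomalousDissipation.AnomalousDissipation.Theorems.SolenoidalFractalHomogenisation.LagrangianStep.WEvenCert
open Summit.AnomalousDissipation.AnomalousDissipation.Theorems.SolenoidalFractalHomogenisation.LagrangianStep.D1TailCert
open Summit.AnomalousDissipation.AnomalousDissipation.Theorems.SolenoidalFractalHomogenisation.LagrangianStep.Sideband
open Summit.AnomalousDissipation.AnomalousDissipation.Theorems.SolenoidalFractalHomogenisation.PermissibleCarrier
  (period_pos start_nonneg start_add_tau_le_period)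
open Summit.AnomalousDissipation.AnomalousDissipation.Theorems.SolenoidalFractalHomogenisation.RealisedQuasiStaticCellLaw (start_add_tau_le_start)
open Literature.Analysis Literature.Analysis.FluidPDE Literature.Analysis.FunctionSpaces Literature.Analysis.FunctionSpaces.Torus
open Literature.Analysis.FluidPDE.Torus Literature.Analysis.FluidPDE.LatticeShear
open Set Real Complex
open scoped InnerProductSpace

/-! ## §1 Slot-data facts of the cubature word -/

/-- `êₗ·z = (vₗ·z)/√nₗ` for the cubature word (`êₗ = vₗ/√nₗ`). [folklore] -/
theorem sum_e_mul_eq (l : Fin 26) (z : Fin 3 → ℤ) :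
    ∑ a, (cubatureWord.phase l).e a * (z a : ℝ) =
      (1 / Real.sqrt (slots l).n) * (((slots l).v 0 * z 0 + (slots l).v 1 * z 1 + (slots l).v 2 * z 2 : ℤ) : ℝ) := by
  rw [(cubatureWord_phase l).2.1]
  simp only [PiLp.smul_apply, smul_eq_mul, Torus.latticeVec_apply, Fin.sum_univ_three]
  push_cast
  ring

/-- A static slot: `vₗ·z = 0 ⇒ êₗ·z = 0` (real form). [folklore] -/
theorem sum_e_mul_eq_zero_of_vdot {l : Fin 26} {z : Fin 3 → ℤ}
    (h : (slots l).v 0 * z 0 + (slots l).v 1 * z 1 + (slots l).v 2 * z 2 = 0) : ∑ a, (cubatureWord.phase l).e a * (z a : ℝ) = 0 := by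
  rw [sum_e_mul_eq, h]; simp

/-- A static slot: `vₗ·z = 0 ⇒ êₗ·z = 0` (complex form, the shape of `Sideband.linkCoeff_eq_zero_of_static`). [folklore] -/
theorem sum_e_mul_eq_zero_of_vdot_complex {l : Fin 26} {z : Fin 3 → ℤ}
    (h : (slots l).v 0 * z 0 + (slots l).v 1 * z 1 + (slots l).v 2 * z 2 = 0) :
    ∑ a, ((cubatureWord.phase l).e a : ℂ) * (z a : ℂ) = 0 := by
  have h' := congrArg (fun x : ℝ => (x : ℂ)) (sum_e_mul_eq_zero_of_vdot h)
  push_cast at h'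
  exact h'

/-- A hopping slot: `vₗ·z ≠ 0 ⇒ êₗ·z ≠ 0`. [folklore] -/
theorem sum_e_mul_ne_zero_of_vdot {l : Fin 26} {z : Fin 3 → ℤ}
    (h : (slots l).v 0 * z 0 + (slots l).v 1 * z 1 + (slots l).v 2 * z 2 ≠ 0) : ∑ a, (cubatureWord.phase l).e a * (z a : ℝ) ≠ 0 := by
  rw [sum_e_mul_eq]
  have hn : 0 < ((slots l).n : ℝ) := by exact_mod_cast (slots_ok l).2.1
  have hs : 0 < Real.sqrt (slots l).n := Real.sqrt_pos.2 hn
  refine mul_ne_zero (by positivity) ?_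
  exact_mod_cast h

/-- `|mᵢ|² ≤ 3` for every slot of the cubature word. [folklore] -/
theorem freqNormSq_slots_le (i : Fin 26) : freqNormSq (cubatureWord.phase i).m ≤ 3 ∧ 1 ≤ freqNormSq (cubatureWord.phase i).m := by
  rw [← Torus.norm_latticeVec_sq, norm_m_sq]
  rcases class_data i with ⟨h, -⟩ | ⟨h, -⟩ | ⟨h, -⟩ <;> rw [h] <;> norm_num

/-- **The ladder coupling is at most `√3/2`**: `a = 2π|êᵢ·m_{j'}|‖αᵢ‖ = |êᵢ·m_{j'}|/(2|mᵢ|)`, `|êᵢ·m_{j'}| ≤ ‖m_{j'}‖ ≤ √3`, `|mᵢ| ≥ 1`; stated as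
`a² ≤ 3/4` for the singly stretched word (same phases). [cite: MeshalkinSinai1961, pp. 1700–1705] -/
theorem coupling_sq_le (i j' : Fin 26) :
    (2 * Real.pi * |∑ a, ((cubatureWord.stretch MB MB_pos).phase i).e a * ((((cubatureWord.stretch MB MB_pos).phase j').m a : ℤ) : ℝ)| *
      ‖slotAmp (cubatureWord.stretch MB MB_pos) i‖) ^ 2 ≤ 3 / 4 := by
  have he : ((cubatureWord.stretch MB MB_pos).phase i).e = (cubatureWord.phase i).e := rfl
  have hm : ((cubatureWord.stretch MB MB_pos).phase j').m = (cubatureWord.phase j').m := rfl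
  have hmi : ((cubatureWord.stretch MB MB_pos).phase i).m = (cubatureWord.phase i).m := rfl
  rw [he, hm, norm_slotAmp, hmi]
  -- Cauchy–Schwarz: `(ê·m')² ≤ ‖ê‖²‖m'‖² = ‖m'‖² ≤ 3`
  have hinner : ∑ a, (cubatureWord.phase i).e a * (((cubatureWord.phase j').m a : ℤ) : ℝ) =
      ⟪(cubatureWord.phase i).e, latticeVec (cubatureWord.phase j').m⟫_ℝ := by
    rw [EuclideanSpace.inner_eq_star_dotProduct]
    simp only [star_trivial, dotProduct, Torus.latticeVec_apply]
    exact Finset.sum_congr rfl fun a _ => by ring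
  have hCS : (∑ a, (cubatureWord.phase i).e a * (((cubatureWord.phase j').m a : ℤ) : ℝ)) ^ 2 ≤ 3 := by
    rw [hinner]
    have h1 := real_inner_mul_inner_self_le (cubatureWord.phase i).e (latticeVec (cubatureWord.phase j').m)
    rw [real_inner_self_eq_norm_sq, real_inner_self_eq_norm_sq, (cubatureWord.phase i).e_unit, one_pow, one_mul, norm_m_sq] at h1
    rcases class_data j' with ⟨h, -⟩ | ⟨h, -⟩ | ⟨h, -⟩ <;> rw [h] at h1 <;> nlinarith
  have hmpos : 0 < ‖latticeVec (cubatureWord.phase i).m‖ := D1TailCert.norm_m_pos i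
  have hm1 : 1 ≤ ‖latticeVec (cubatureWord.phase i).m‖ ^ 2 := by
    rw [norm_m_sq]; rcases class_data i with ⟨h, -⟩ | ⟨h, -⟩ | ⟨h, -⟩ <;> rw [h] <;> norm_num
  have hπ : 0 < Real.pi := Real.pi_pos
  have e1 : 2 * Real.pi * |∑ a, (cubatureWord.phase i).e a * (((cubatureWord.phase j').m a : ℤ) : ℝ)| *
      (1 / (2 * (2 * Real.pi * ‖latticeVec (cubatureWord.phase i).m‖))) =
      |∑ a, (cubatureWord.phase i).e a * (((cubatureWord.phase j').m a : ℤ) : ℝ)| / (2 * ‖latticeVec (cubatureWord.phase i).m‖) := by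
    field_simp
  rw [e1, div_pow, sq_abs]
  rw [div_le_div_iff₀ (by positivity) (by norm_num)]
  nlinarith

/-- **FEASIBILITY OF THE CRUSH WINDOW SHAPE for the cubature word** in the sectorial block window (`l = 10/11`, `h = 11/10`, `β = 11/200 = (1/20)·(11/10)`):
`128·(β/(2l)·(1+Mo))² ≤ S₀` whenever `a² ≤ 3/4` and `1 ≤ m₂ ≤ 3` (true with a factor `> 2` to spare). [folklore] -/
theorem crush_feasible {a m₂ S₀ Mo : ℝ} (ha : a ^ 2 ≤ 3 / 4) (hm₂ : m₂ ≤ 3) (hm₂' : 1 ≤ m₂)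
    (hS₀ : S₀ = 4 * (4 * a ^ 2) + 16 * (8 * a ^ 2 * (1 + m₂) * (11 / 10) / (10 / 11)) + 1) (hMo : Mo = 8 * a ^ 2 * (1 + m₂)) :
    128 * ((11 / 200) / (2 * (10 / 11)) * (1 + Mo)) ^ 2 ≤ S₀ := by
  rw [hS₀, hMo]
  have hA : 0 ≤ a ^ 2 := sq_nonneg a
  have hX : a ^ 2 * (1 + m₂) ≤ 3 := by nlinarith
  have hX0 : 0 ≤ a ^ 2 * (1 + m₂) := by nlinarith
  nlinarith [mul_nonneg hX0 (sub_nonneg.2 hX)]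


/-- `OddSmall` is monotone in the bound. [cite: Avron1998OddViscosity, §2 eq. (1)-(2)] -/
theorem oddSmall_mono {S : T4} {β β' : ℝ} (h : Torus.OddSmall S β) (hβ : 0 ≤ β) (hle : β ≤ β') : Torus.OddSmall S β' :=
  fun k p q hp hq => (h k p q hp hq).trans (mul_le_mul_of_nonneg_right (pow_le_pow_left₀ hβ hle 2) (by positivity))

/-- The sup-norm of the slot vectors of the (stretched) cubature word is `≤ 1`, real form. [folklore] -/
theorem abs_m_stretch_le_one (i : Fin 26) (c : Fin 3) : |((((cubatureWord.stretch MB MB_pos).phase i).m c : ℤ) : ℝ)| ≤ 1 := by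
  show |(((slots i).m c : ℤ) : ℝ)| ≤ 1
  rcases slots_m_entry i c with h | h | h <;> rw [h] <;> norm_num

/-! ## §2 ν-bookkeeping: the box condition and the period gap -/

/-- **THE BOX CONDITION of the crush at the truncation radius `R0 ν`**, `ν = r³`: for `r ≤ 1/4` and `r ≤ 1/(C_R + 1)`,
`C_R ≤ (R0 r³ − 1)·r²` and `1 < R0 r³` (`R0 ν ≥ ν⁻³ = r⁻⁹`). [cite: MajdaKramer1999, §2.2.1.3] -/
theorem box_condition_R0 {CR r : ℝ} (hCR : 0 < CR) (hr : 0 < r) (hr4 : r ≤ 1 / 4) (hrC : r ≤ 1 / (CR + 1)) :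
    CR ≤ ((R0 (r ^ 3) : ℝ) - 1) * r ^ 2 ∧ (1 : ℝ) < R0 (r ^ 3) := by
  have hν : 0 < r ^ 3 := pow_pos hr 3
  have h9 : 1 / r ^ 9 ≤ (R0 (r ^ 3) : ℝ) := by
    have h := nu_cube_mul_R0 hν
    rw [div_le_iff₀ (by positivity)]
    calc (1:ℝ) ≤ (r ^ 3) ^ 3 * R0 (r ^ 3) := h
      _ = (R0 (r ^ 3) : ℝ) * r ^ 9 := by ring
  have hinv : CR + 1 ≤ 1 / r := by
    rw [le_div_iff₀ hr]
    have := (le_div_iff₀ (by positivity : (0:ℝ) < CR + 1)).1 hrC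
    linarith
  have hone : (1:ℝ) ≤ 1 / r := le_trans (by linarith) hinv
  have h7 : 1 / r ≤ (1 / r) ^ 7 := le_self_pow₀ hone (by norm_num)
  have h9' : 1 / r ≤ (1 / r) ^ 9 := le_self_pow₀ hone (by norm_num)
  have hr2 : r ^ 2 ≤ 1 / 16 := by nlinarith
  have hrne : r ≠ 0 := hr.ne'
  refine ⟨?_, ?_⟩
  · have e1 : (1 / r ^ 9 - 1) * r ^ 2 = (1 / r) ^ 7 - r ^ 2 := by field_simp
    have hmono : (1 / r ^ 9 - 1) * r ^ 2 ≤ ((R0 (r ^ 3) : ℝ) - 1) * r ^ 2 :=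
      mul_le_mul_of_nonneg_right (sub_le_sub_right h9 1) (sq_nonneg r)
    rw [e1] at hmono
    linarith
  · have e2 : (1 / r) ^ 9 = 1 / r ^ 9 := by rw [one_div_pow]
    have four : (4:ℝ) ≤ 1 / r := by rw [le_div_iff₀ hr]; linarith
    linarith [h9, h9', e2 ▸ h9']

/-- **THE PERIOD GAP OF THE HOPPING SLOT IS AT LEAST `θmin`**: with `ν = r³ ≤ 1/40`, `W₁ = (cubatureWord.stretch MB).stretch (1/r³)`,
`e^{−min(1, 4π²ν·10/11)·(P¹ − τᵢ¹)} ≤ e^{−θmin}` (`P¹ − τᵢ¹ = MB(3720 − τᵢ)/ν ≥ 40·MB/ν`). [cite: ArmstrongVicol2025, §3] -/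
theorem gap_le_exp_neg_θmin (i : Fin 26) {r : ℝ} (hr : 0 < r) (hν40 : r ^ 3 ≤ 1 / 40) (h₁ : (0:ℝ) < 1 / r ^ 3) :
    Real.exp (-(min (1:ℝ) (4 * π ^ 2 * (r ^ 3 * (10 / 11))) *
        (((cubatureWord.stretch MB MB_pos).stretch (1 / r ^ 3) h₁).period - 1 / r ^ 3 * ((cubatureWord.stretch MB MB_pos).phase i).τ))) ≤
      Real.exp (-θmin) := by
  have hν : 0 < r ^ 3 := pow_pos hr 3
  rw [Real.exp_le_exp, neg_le_neg_iff, min_one_viscRate ⟨hν, hν40⟩, PermissibleCarrier.period_stretch, PermissibleCarrier.period_stretch,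
    period_cubatureWord]
  show θmin ≤ 4 * π ^ 2 * (r ^ 3 * (10 / 11)) * (1 / r ^ 3 * (MB * 3720) - 1 / r ^ 3 * (MB * (cubatureWord.phase i).τ))
  unfold θmin
  have hτ : (cubatureWord.phase i).τ ≤ 243 := by
    rcases class_data i with ⟨-, h⟩ | ⟨-, h⟩ | ⟨-, h⟩ <;> rw [h] <;> norm_num
  have e : 4 * π ^ 2 * (r ^ 3 * (10 / 11)) * (1 / r ^ 3 * (MB * 3720) - 1 / r ^ 3 * (MB * (cubatureWord.phase i).τ)) =
      4 * π ^ 2 * (10 / 11) * MB * (3720 - (cubatureWord.phase i).τ) := by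
    field_simp
  rw [e]
  have hMB : 0 < MB := MB_pos
  have hπ : 0 < π ^ 2 := by positivity
  have h0 : 0 ≤ 4 * π ^ 2 * (10 / 11) * MB := by positivity
  nlinarith [mul_le_mul_of_nonneg_left (show (40:ℝ) ≤ 3720 - (cubatureWord.phase i).τ by linarith) h0]


/-! ## §3 The crushed state -/

/-- **THE CRUSHED STATE of the cubature word's periodic sideband response.**  Source slot `j'`, a slot `i ≠ j'` HOPPING `m_{j'}` (`vᵢ·m_{j'} ≠ 0`)
such that every slot cyclically strictly between `j'` and `i` is STATIC for `m_{j'}` (`v_l·m_{j'} = 0`).  Then there are ν-FREE `C > 0` and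
`r₁ ∈ (0, 1/4]` such that for every `r ∈ (0, r₁]` (`ν = r³`), every background `S ∈ NearIso(10/11, 11/10) ∩ OddSectorial(τ ≤ 1/20)` and every `v`,
the periodic response `N̄ = responseExt W₁ (ν•S) 1 (R0 ν) j'` of the doubly stretched word `W₁ = (cubatureWord.stretch MB).stretch (1/ν)` satisfies, at
the END of the hopping slot, `‖N̄ (startᵢ¹ + τᵢ¹) v‖ ≤ C·√(r³)·(8π‖α¹_{j'}‖/r_ν)·‖P_{j'} v‖` — lane A4's state bound with `C√ν` in place of `e^{−θmin}`.
[cite: BedrossianCotiZelati2017, §2 (hypocoercivity, enhanced dissipation)] [cite: ArmstrongVicol2025, §3] [cite: SandersVerhulstMurdock2007, Lemma 5.2.7] -/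
theorem crushed_state (j' i : Fin 26) (hij : i ≠ j')
    (hhop : (slots i).v 0 * (slots j').m 0 + (slots i).v 1 * (slots j').m 1 + (slots i).v 2 * (slots j').m 2 ≠ 0)
    (hstat : ∀ l : Fin 26, l ≠ j' → ((j' < l ∧ l < i) ∨ (i < j' ∧ (j' < l ∨ l < i))) →
      (slots l).v 0 * (slots j').m 0 + (slots l).v 1 * (slots j').m 1 + (slots l).v 2 * (slots j').m 2 = 0) :
    ∃ C r₁ : ℝ, 0 < C ∧ 0 < r₁ ∧ r₁ ≤ 1 / 4 ∧ ∀ {r : ℝ} (hr : 0 < r), r ≤ r₁ →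
      ∀ {S : T4}, Torus.NearIso S (10 / 11) (11 / 10) → ∀ τ ∈ Icc (0:ℝ) (1 / 20), OddSectorial S τ → ∀ v : EuclideanSpace ℂ (Fin 3),
      ‖responseExt ((cubatureWord.stretch MB MB_pos).stretch (1 / r ^ 3) (by positivity)) (r ^ 3 • S) 1 (R0 (r ^ 3)) j'
          (((cubatureWord.stretch MB MB_pos).stretch (1 / r ^ 3) (by positivity)).start i +
            1 / r ^ 3 * ((cubatureWord.stretch MB MB_pos).phase i).τ) v‖ ≤
        C * Real.sqrt (r ^ 3) * (8 * π * ‖slotAmp ((cubatureWord.stretch MB MB_pos).stretch (1 / r ^ 3) (by positivity)) j'‖ /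
          min (1:ℝ) (4 * π ^ 2 * (r ^ 3 * (10 / 11))) * ‖transversalProj (cubatureWord.phase j').m v‖) := by
  -- the ν-free engine constants
  have hhop' : ∑ a, ((cubatureWord.stretch MB MB_pos).phase i).e a * ((((cubatureWord.stretch MB MB_pos).phase j').m a : ℤ) : ℝ) ≠ 0 :=
    sum_e_mul_ne_zero_of_vdot hhop
  obtain ⟨K, CR, hK, hCR, hmain⟩ := norm_responseExt_le_crushed_nu (cubatureWord.stretch MB MB_pos) i j' hhop' (M := 1)
    (abs_m_stretch_le_one i) (l := 10 / 11) (h := 11 / 10) (β := 11 / 200) (by norm_num) (by norm_num) (by norm_num) rfl rfl rfl rfl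
    (crush_feasible (coupling_sq_le i j') (freqNormSq_slots_le i).1 (freqNormSq_slots_le i).2 rfl rfl)
  refine ⟨4 * Real.sqrt K, min (1 / 4) (1 / (CR + 1)), by positivity, by positivity, min_le_left _ _, ?_⟩
  intro r hr hr1 S hS τ hτ hodd v
  have hr4 : r ≤ 1 / 4 := hr1.trans (min_le_left _ _)
  have hrC : r ≤ 1 / (CR + 1) := hr1.trans (min_le_right _ _)
  have hν : 0 < r ^ 3 := pow_pos hr 3
  have hν40 : r ^ 3 ≤ 1 / 40 := by
    have h := pow_le_pow_left₀ hr.le hr4 3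
    linarith [show ((1:ℝ) / 4) ^ 3 ≤ 1 / 40 by norm_num]
  have hr1' : r ≤ 1 := by linarith
  obtain ⟨hbox, hR⟩ := box_condition_R0 hCR hr hr4 hrC
  have hR' : (1:ℝ) < (R0 (r ^ 3) : ℕ) := hR
  have hτ2 : 2 * r ^ 2 ≤ ((cubatureWord.stretch MB MB_pos).phase i).τ := by
    show 2 * r ^ 2 ≤ MB * (cubatureWord.phase i).τ
    have hτ : (40:ℝ) ≤ (cubatureWord.phase i).τ := by
      rcases class_data i with ⟨-, h⟩ | ⟨-, h⟩ | ⟨-, h⟩ <;> rw [h] <;> norm_num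
    have hMB : MB = 1 / 50 := rfl
    rw [hMB]; nlinarith
  have h𝔸 : Torus.NearIso (r ^ 3 • S) (r ^ 3 * (10 / 11)) (r ^ 3 * (11 / 10)) := hS.smul hν.le
  have hoddS : Torus.OddSmall S (11 / 200) :=
    oddSmall_mono (hodd.oddSmall hS (by norm_num) hτ.1) (by nlinarith [hτ.1]) (by nlinarith [hτ.2])
  have hodd' : Torus.OddSmall (r ^ 3 • S) (r ^ 3 * (11 / 200)) := hoddS.smul (r ^ 3)
  -- the fixed-point bound at `p = 0`
  have h0 := @hmain (R0 (r ^ 3)) (by exact_mod_cast hR) r hr hr1' hbox hτ2 (r ^ 3 • S) h𝔸 hodd' 1 one_pos 0 v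
  simp only [Int.cast_zero, zero_mul, add_zero] at h0
  set W₁ := (cubatureWord.stretch MB MB_pos).stretch (1 / r ^ 3) (by positivity) with hW₁
  have hθ := gap_le_exp_neg_θmin i hr hν40 (by positivity)
  have hθ1 : Real.exp (-θmin) < 1 := lt_of_le_of_lt exp_neg_θmin_le (by norm_num)
  have hstatC : ∀ l : Fin 26, l ≠ j' → ((j' < l ∧ l < i) ∨ (i < j' ∧ (j' < l ∨ l < i))) →
      ∑ a, ((W₁.phase l).e a : ℂ) * ((W₁.phase j').m a : ℂ) = 0 :=
    fun l hl h => sum_e_mul_eq_zero_of_vdot_complex (hstat l hl h)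
  -- the two placements of the source window
  have hbound : ‖responseExt W₁ (r ^ 3 • S) 1 (R0 (r ^ 3)) j' (W₁.start i + 1 / r ^ 3 * ((cubatureWord.stretch MB MB_pos).phase i).τ) v‖ ≤
      2 * Real.sqrt (K * r ^ 3) / (1 - Real.exp (-θmin)) * ‖responseExt W₁ (r ^ 3 • S) 1 (R0 (r ^ 3)) j' (W₁.start i) v‖ := by
    rcases lt_or_gt_of_ne hij with hlt | hgt
    · -- `i < j'`: the source window one period earlier
      obtain ⟨has, heP⟩ := window_of_gt W₁ hlt
      exact h0 has heP (hstatic_of_gt W₁ hlt (fun l h => hstatC l (h.elim (fun h => ne_of_gt h) (fun h => ne_of_lt (h.trans hlt)))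
        (Or.inr ⟨hlt, h⟩)) (R0 (r ^ 3))) (hsrc_of_gt W₁ j' i) hθ hθ1
    · -- `j' < i`: the source window in the same period
      obtain ⟨has, heP⟩ := window_of_lt W₁ hgt
      exact h0 has heP (hstatic_of_lt W₁ (fun l h1 h2 => hstatC l (ne_of_gt h1) (Or.inl ⟨h1, h2⟩)) (R0 (r ^ 3))) (hsrc_of_lt W₁ hgt) hθ hθ1
  -- the a priori bound at the start of the hopping slot and the constants
  have hsup := norm_responseExt_apply_le W₁ h𝔸 (by positivity : (0:ℝ) < r ^ 3 * (10 / 11)) one_pos (R0 (r ^ 3)) j' (W₁.start i) v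
  have hSUP0 : 0 ≤ 8 * π * ‖slotAmp W₁ j'‖ / min (1:ℝ) (4 * π ^ 2 * (r ^ 3 * (10 / 11))) * ‖transversalProj (cubatureWord.phase j').m v‖ := by
    have : 0 < min (1:ℝ) (4 * π ^ 2 * (r ^ 3 * (10 / 11))) := lt_min one_pos (by positivity)
    positivity
  have hθhalf : (1:ℝ) / 2 ≤ 1 - Real.exp (-θmin) := by have := exp_neg_θmin_le; norm_num at this ⊢; linarith
  have hsqrt : Real.sqrt (K * r ^ 3) = Real.sqrt K * Real.sqrt (r ^ 3) := Real.sqrt_mul hK.le _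
  have hfac : 2 * Real.sqrt (K * r ^ 3) / (1 - Real.exp (-θmin)) ≤ 4 * Real.sqrt K * Real.sqrt (r ^ 3) := by
    rw [hsqrt, div_le_iff₀ (by linarith)]
    have : 0 ≤ Real.sqrt K * Real.sqrt (r ^ 3) := by positivity
    nlinarith
  calc ‖responseExt W₁ (r ^ 3 • S) 1 (R0 (r ^ 3)) j' (W₁.start i + 1 / r ^ 3 * ((cubatureWord.stretch MB MB_pos).phase i).τ) v‖
      ≤ 2 * Real.sqrt (K * r ^ 3) / (1 - Real.exp (-θmin)) * ‖responseExt W₁ (r ^ 3 • S) 1 (R0 (r ^ 3)) j' (W₁.start i) v‖ := hbound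
    _ ≤ (4 * Real.sqrt K * Real.sqrt (r ^ 3)) *
        (8 * π * ‖slotAmp W₁ j'‖ / min (1:ℝ) (4 * π ^ 2 * (r ^ 3 * (10 / 11))) * ‖transversalProj (cubatureWord.phase j').m v‖) :=
        mul_le_mul hfac hsup (norm_nonneg _) (by positivity)
    _ = 4 * Real.sqrt K * Real.sqrt (r ^ 3) *
        (8 * π * ‖slotAmp W₁ j'‖ / min (1:ℝ) (4 * π ^ 2 * (r ^ 3 * (10 / 11))) * ‖transversalProj (cubatureWord.phase j').m v‖) := rfl

end Summit.AnomalousDissipation.AnomalousDissipation.Theorems.SolenoidalFractalHomogenisation.LagrangianStep.D1Tail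

end
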